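import Literature.Topology.Immersions.ProjectionFieldBundle
import HarnessLib

/-!
# Morphisms and isomorphisms of projection-field bundles; close projection fields are isomorphic

Topic `Literature/Topology/Immersions`. Bundle maps between the tree's projection-field bundles
(`ProjectionFieldBundle.lean`: a rank-`k` bundle over `M` inside `M × ℝᵐ` as a smooth field of
orthogonal projections) are smooth fields of linear maps carrying fibres into fibres
(Milnor–Stasheff, *Characteristic Classes* (1974), §2–§3: bundle maps, isomorphisms; Lemma 2.3:
a fibrewise bijective bundle map over the identity is an isomorphism). The main point recorded
here is the classical **stability of sub-bundles**: two rank-`k` projection fields `P, P'` in the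
same `ℝᵐ` with `‖P_x - P'_x‖ < 1` everywhere are isomorphic through `v ↦ P'_x v`
(Husemoller, *Fibre Bundles*, Ch. 3 §8 flavour; the linear algebra: if `P' v = 0` for
`v = P v` then `v = (P - P') v`, so `‖v‖ < ‖v‖` unless `v = 0`) — the form in which the normal
bundle of an immersion is seen not to change under a `C¹`-small perturbation.

* `ProjBundle.IsHom P P' Φ` — `Φ : M → (ℝᵐ →L ℝᵐ')` is `C^∞` and maps `E_x` into `E'_x`;
  `ProjBundle.IsIso` — moreover injective on `E_x` (hence bijective `E_x → E'_x`, ranks being equal);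
* `ProjBundle.IsIso.bijOn` — an iso is a fibrewise linear bijection;
* `ProjBundle.isIso_proj_of_norm_sub_lt_one` — **close projection fields are isomorphic** via
  `Φ = P'`.

Everything here is proved; no named facts are introduced (two `Prop`-valued predicates with
explicit parameters, `IsHom`, `IsIso`).

## References

* J. Milnor, J. Stasheff, *Characteristic Classes* (1974), §2 (bundle maps), Lemma 2.3, §3.
  [MilnorStasheff1974]
* D. Husemoller, *Fibre Bundles*, 3rd ed. (1994), Ch. 3 (morphisms of vector bundles).
  [HusemollerFibreBundles1994]
-/

open scoped Manifold ContDiff Topology RealInnerProductSpace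
open Set Function Module

noncomputable section

namespace Literature.Topology.Immersions

/-- Local notation: `𝔼 n` is the model Euclidean space `EuclideanSpace ℝ (Fin n)`. -/
local notation "𝔼 " n:arg => EuclideanSpace ℝ (Fin n)

namespace ProjBundle

variable {n m m' k : ℕ} {M : Type*} [TopologicalSpace M] [ChartedSpace (𝔼 n) M]

/-- A **bundle map** `E(P) → E(P')` over the identity of `M`: a `C^∞` field of linear maps
`Φ_x : ℝᵐ →L ℝᵐ'` with `Φ_x(E_x) ⊆ E'_x` (Milnor–Stasheff §2). [cite: MilnorStasheff1974, §2] -/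
structure IsHom (P : ProjBundle n m k M) (P' : ProjBundle n m' k M) (Φ : M → 𝔼 m →L[ℝ] 𝔼 m') :
    Prop where
  contMDiff : ContMDiff (𝓡 n) 𝓘(ℝ, 𝔼 m →L[ℝ] 𝔼 m') ∞ Φ
  mapsTo : ∀ x, ∀ v ∈ P.fibre x, Φ x v ∈ P'.fibre x

/-- A **bundle isomorphism** over the identity: a bundle map injective on every fibre (hence, the
ranks being equal, a linear bijection `E_x → E'_x`, Milnor–Stasheff Lemma 2.3).
[cite: MilnorStasheff1974, §2 Lemma 2.3] -/
structure IsIso (P : ProjBundle n m k M) (P' : ProjBundle n m' k M) (Φ : M → 𝔼 m →L[ℝ] 𝔼 m') :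
    Prop extends IsHom P P' Φ where
  injOn : ∀ x, InjOn (Φ x) (P.fibre x)

/-- The finite rank of a fibre is `k`. [folklore] -/
theorem finrank_fibre (P : ProjBundle n m k M) (x : M) : finrank ℝ (P.fibre x) = k :=
  P.finrank_range x

/-- **An isomorphism is a fibrewise linear bijection** `E_x → E'_x`. [cite: MilnorStasheff1974, §2 Lemma 2.3] -/
theorem IsIso.bijOn {P : ProjBundle n m k M} {P' : ProjBundle n m' k M} {Φ : M → 𝔼 m →L[ℝ] 𝔼 m'}
    (h : IsIso P P' Φ) (x : M) : BijOn (Φ x) (P.fibre x) (P'.fibre x) := by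
  refine ⟨fun v hv => h.mapsTo x v hv, h.injOn x, ?_⟩
  -- the restriction `E_x → E'_x` is an injective linear map between spaces of dimension `k`
  let A : P.fibre x →ₗ[ℝ] P'.fibre x :=
    { toFun := fun v => ⟨Φ x v, h.mapsTo x v v.2⟩
      map_add' := fun v w => by
        ext1
        simp
      map_smul' := fun c v => by
        ext1
        simp }
  have hAinj : Injective A := by
    intro v w hvw
    have := congrArg Subtype.val hvw
    exact Subtype.ext (h.injOn x v.2 w.2 this)
  have hAsurj : Surjective A :=
    (LinearMap.injective_iff_surjective_of_finrank_eq_finrank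
      (by rw [P.finrank_fibre, P'.finrank_fibre])).1 hAinj
  intro w hw
  obtain ⟨v, hv⟩ := hAsurj ⟨w, hw⟩
  exact ⟨v, v.2, congrArg Subtype.val hv⟩

/-- The identity is an isomorphism. [folklore] -/
theorem isIso_id (P : ProjBundle n m k M) : IsIso P P fun _ => ContinuousLinearMap.id ℝ (𝔼 m) :=
  { contMDiff := contMDiff_const
    mapsTo := fun _ _ hv => hv
    injOn := fun _ _ _ _ _ h => h }

/-! ### Close projection fields are isomorphic -/

/-- **Stability of sub-bundles**: if two rank-`k` projection fields in the same `ℝᵐ` satisfy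
`‖P_x - P'_x‖ < 1` at every point, then `v ↦ P'_x v` is a bundle isomorphism `E(P) ≅ E(P')`:
for `v ∈ E_x` with `P'_x v = 0` one has `v = (P_x - P'_x) v`, so `‖v‖ ≤ ‖P_x - P'_x‖ ‖v‖` forces
`v = 0`. [cite: MilnorStasheff1974, §3 Thm. 3.3] -/
theorem isIso_proj_of_norm_sub_lt_one (P P' : ProjBundle n m k M)
    (h : ∀ x, ‖P.proj x - P'.proj x‖ < 1) : IsIso P P' P'.proj := by
  refine ⟨⟨P'.contMDiff_proj', fun x v _ => P'.proj_mem_fibre x v⟩, fun x => ?_⟩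
  -- injectivity on the fibre from the norm estimate
  have key : ∀ v ∈ P.fibre x, P'.proj x v = 0 → v = 0 := by
    intro v hv h0
    have hPv : P.proj x v = v := P.mem_fibre_iff.1 hv
    have hv' : (P.proj x - P'.proj x) v = v := by
      show P.proj x v - P'.proj x v = v
      rw [hPv, h0, sub_zero]
    by_contra hne
    have hpos : 0 < ‖v‖ := norm_pos_iff.2 hne
    have hle : ‖v‖ ≤ ‖P.proj x - P'.proj x‖ * ‖v‖ := by
      conv_lhs => rw [← hv']
      exact ContinuousLinearMap.le_opNorm _ v
    have hlt : ‖P.proj x - P'.proj x‖ * ‖v‖ < 1 * ‖v‖ := mul_lt_mul_of_pos_right (h x) hpos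
    rw [one_mul] at hlt
    exact absurd (hle.trans_lt hlt) (lt_irrefl _)
  intro v hv w hw hvw
  have hsub : v - w ∈ P.fibre x := Submodule.sub_mem _ hv hw
  have h0 : P'.proj x (v - w) = 0 := by rw [map_sub, hvw, sub_self]
  exact sub_eq_zero.1 (key _ hsub h0)

end ProjBundle

end Literature.Topology.Immersions
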